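import Literature.MathematicalPhysics.QuantumFieldTheory.BalabanImbrieJaffe1984to88.BIJ88RT52Restrictions
import Literature.MathematicalPhysics.QuantumFieldTheory.BalabanImbrieJaffe1984to88.BIJ88Sect5StatementsPart3

/-!
# `BalabanImbrieJaffe1984to88.BIJ88Eq528Density` — T. Bałaban, J. Imbrie, A. Jaffe, *Effective action and cluster properties of the
abelian Higgs model*, Commun. Math. Phys. **114** (1988) 257–315 [BalabanImbrieJaffe1988], Sect. 5.2 pp. 278–279 [PDF 22–23]: the display
**(5.2.8)** *"Our density now has the form …"* — THE DENSITY AFTER THE RESTRICTIONS — PROVED AT MEASURE LEVEL with the PRINTED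
characteristic functions `χ_x, χ_y, χ_b, χ_p` of (5.2.2) (r16's `chiX`, `chiY`, `chiB`, `chiP`) evaluated on the fields, and the printed
weights `ζ_{Λ₀^{(k)c}}`, `χ_{Λ₀^{(k)}}` of (5.2.7) (r16's `zeta527`, `chi527`, summing to `1` by r16's (5.2.6) `eq526`) (file 2/2; file 1/2
`BIJ88RT52Restrictions` = the `ψ`-dependent display `IsRD` and the insertion step `insert_partition`).

statement-level skeleton of published theorems with citation tags; proofs where landed; nothing here is a claim about the Yang–Mills mass gap

PDF held: `paper:balaban1988-cmp114-bij-abelian-higgs-effective-action` (journal page = PDF page + 256); pp. 277–279 [PDF 21–23] read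
(`lit read … --pages 21-25`; r16's render `HOME/lit-balaban-r16/renders/cmp114/original-p022-x2.png`).

CITATION HEADER (lean-in-tree rule).  Part of the lit-balaban TYPED SKELETON (HOME `run/shared/lean/pub/lit-balaban/`), PHASE-2 proof seat
p34 gen 8 (unit `lit-balaban-p34-g8`; TAKING line HOME/STATUS.md 2026-08-21T18:44:37Z; own lineage = the C1/C2 renormalization-transformation
line).  Row served: **`C2.Eq5.2.6-5.2.8`** of `HOME/lit-balaban-r16/ROWS-C2-part2.md` (fold owner r16; before: *"(5.2.8) density display absent"*).

THE PRINTED TEXT (p. 279 [PDF 23], verbatim).  *"Our density now has the form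
ρ̃^L_{k+1}(v, ψ) = Σ_{{X_ω}} Σ_{Λ₀^{(k)}} ∫𝒟u δ(v/Qu) δ_{Ax}(u) ∫ Π_{j=0}^{k−1} 𝒟u^{(j)}_{Λ₁₀^{(j)c*}} ∫𝒟φ ζ_{Λ₀^{(k)c}} χ_{Λ₀^{(k)}} χ_{k,Λ₀^{(k−1)′}}
Π_ω g_k(X_ω) Π_σ F_{k,loc}(X_σ) Π_{j=0}^{k−1}[Z^{(j)}_{Λ₁₀^{(j)c*c}} Z^{(j)}_{Λ₁₀^{(j)}}(u_k)] × exp[−½⟨Λ₅^{(k−1)′**}f^{(k)}, σ_{k,loc}Λ₅^{(k−1)′**}f^{(k)}⟩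
− ½aL⁻²⟨ψ − Q(u_k)φ, ψ − Q(u_k)φ⟩ − ½⟨Λ₈^{(k−1)′}φ, Δ_{k,loc}(u_k)Λ₈^{(k−1)′}φ⟩ − 𝒫_{k,loc}(Λ₈^{(k−1)}) − ℰ_k − E^{(k)}]. (5.2.8)"*; before it
(p. 279): *"We resum the partition of unity to obtain 1 = Σ_{Λ₀^{(k)}} ζ_{Λ₀^{(k)c}} χ_{Λ₀^{(k)}}, (5.2.6) where ζ_{Λ₀^{(k)c}} = Σ_{P_x,P_y,P_b,P_p} Π χ^c
⋯ Π χ, χ_{Λ₀^{(k)}} = Π_{x∈Λ₀^{(k)}} χ_x ⋯ Π_{p∈Λ₀^{(k)**}} χ_p. (5.2.7) Here the sum is over subsets compatible with Λ₀^{(k)c}, Λ₁₃^{(k−1)}"*; and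
(5.2.2) p. 278: *"χ_x = χ(λ_kp(e_k), |φ(x)|), if (L^kε)^d < λ; χ((L^kε)^{−1}p(e_k), ||φ| − (8λ)^{−1/2}(L^kε)^{(d−2)/2}|), if (L^kε)^d ≧ λ; χ_y =
χ(p(e_k), |(ψ − Q(u_k)φ)(y)|), χ_b = χ(p(e_k), |(D_{ū_k}φ)(b)|), χ_p = χ(e_kp(e_k), |u(p) − 1|)"*.

READING (the objects of record).  The display is (5.1.1)-with-(5.1.4) (gen 5's `BIJ88RT51GeneralStep.IsRT511Ax`, *"∫𝒟u δ(v/Qu) δ_{Ax}(u)"*)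
after the insertion of (5.2.6): in file 1's `ψ`-dependent reading `IsRD (𝒟u δ_{Ax})`, the term family becomes (terms `{X_ω}`) × (regions
`Λ₀^{(k)}` of the term) and the integrand becomes `ζ_{Λ₀^{(k)c}} χ_{Λ₀^{(k)}} · ρ′_k` — `ρ′_k = χ_k Πg_k ΠF_{k,loc} Π[ZZ] exp[−½⟨f,σf⟩ − ½⟨φ,Δφ⟩ −
𝒫 − ℰ_k]` being r18's `BIJ88InductiveForm41.rhoPrime` for the terms of (4.1), and the factor `exp[−½aL⁻²⟨ψ − Q(u_k)φ, ·⟩ − E^{(k)}]` of the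
printed exponential being r18's normalized `gaussWeight a (Q(u_k)φ) ψ` kept separate by `IsRD` (as in (5.1.1); `E^{(k)}` per site ↔ total,
gen 5's `E0step_level_eq_normE`).  The "points" `x, y, b, p` of `Λ₁₃^{(k−1)′}, Λ₁₃^{(k−1)″}, Λ₁₃^{(k−1)′*}, Λ₁₃^{(k−1)′**}` are, as in r16's
(5.2.6)/(5.2.7) (`eq526`, one finite index set `S`, region map `R`, *"compatible"* = `R P = Λ₀`), an abstract finite index set per term with
a SPECIES ASSIGNMENT `pt : points → Site ⊕ BlockSite ⊕ Bond ⊕ Plaquette` telling which printed characteristic function sits at each point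
(`chi522`); the covariant block average `Q(u_k)φ` (the background kernel of (5.1.1)) and the bond products `ū_k` of (4.4) entering `χ_b`
are the term's data, as in gens 5–7.

WHAT IS PROVED, and how.
* §1 r16's cutoff profile (5.2.3) is continuous with support in `[−1, 1]`, hence BOUNDED (`exists_abs_chi1_le`; *not* assumed `≤ 1`: the
  structure does not print that), so all `χ(p, x)` are bounded by one constant (`exists_abs_cutoff_le`) and continuous (`continuous_cutoff`).
* §2 the four printed characteristic functions are continuous in their field arguments (`continuous_chiX/chiY/chiB/chiP`); assembled
  by species (`Point`, `Coeff522`, `chi522`) they are jointly measurable on the configurations (`measurable_chi522`, for jointly measurable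
  `Q(u_k)φ` and `ū_k`) and uniformly bounded (`exists_abs_chi522_le`).
* §3 the weight `ζ_{Λ₀^{(k)c}} χ_{Λ₀^{(k)}}` on the configurations (`weight527` = r16's `zeta527 · chi527` at the field-dependent `χ`'s):
  `Σ_{Λ₀} ζχ = 1` pointwise (`sum_weight527`, r16's `eq526`), measurable (`measurable_weight527`), bounded (`exists_norm_weight527_le`).
* §4 **(5.2.8) PROVED** (`density528`): every density `ρ̃` satisfying (5.1.1)+(5.1.4) (`IsRT511Ax`, measurable `Qu`, jointly measurable
  kernels, jointly measurable `𝒟u δ_{Ax} ⊗ Π𝒟u^{(j)} ⊗ 𝒟φ`-integrable term densities `ρ′_t`, `a > 0`, `d ≥ 2`) satisfies the display (5.2.8):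
  `IsRD (𝒟u δ_{Ax}) (Σ_t regions_t) Qu (Q(u_k)φ) a (ζ_{Λ₀ᶜ}χ_{Λ₀} · ρ′_t)` with the printed `χ_x, χ_y, χ_b, χ_p` at the points and any region maps
  (file 1's `IsRT511Ax.insert_partition`); abstract-`χ` form `density528_of_family`; and WITH NO HYPOTHESIS ON `ρ̃`: gen 6's constructed
  `rt51 (𝒟u δ_{Ax})` for the printed block average `Qu` of [2] (2.10) satisfies (5.2.8) (`density528_rt51_printed`).  For the terms of (4.1)
  take `ρ′_t = rhoPrime (T t) ∘ cfg` (gen 6's `bracket_eq_integral_rt51` hypotheses).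
NOT DONE HERE (honest scope).  The region map of p. 279 (*"Λ₀^{(k)} as the union of r(e_k)-blocks, none of whose points are in …"*, r16's
`smallFieldRegion`) and the species bookkeeping of `Λ₁₃^{(k−1)}` stay abstract (`S`, `Rmap`, `pt`), as in r16's `eq526`; the smallness remark
*"we expect to obtain small factors exp(−cp(e_k)²)"* is not a claim here; no bound.  Definitions with bodies (`Point`, `Coeff522`, `chi522`,
`weight527`) and theorems; re-declares nothing; imports Literature + Mathlib only; NO `Prop`-valued fact is introduced; standard axioms.
-/

namespace Literature.MathematicalPhysics.QuantumFieldTheory.BalabanImbrieJaffe1984to88.BIJ88Eq528Density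

open Literature.MathematicalPhysics.QuantumFieldTheory.Balaban1983to89
open BIJ88Sect3Statements (U1 toC cfg covD plaqVar)
open BIJ85Sect1Model (HiggsField)
open BIJ88Sect5Statements (CutoffProfile cutoff)
open BIJ88Sect5StatementsPart3 (chiX chiY chiB chiP zeta527 chi527 eq526)
open BIJ88RenormTransf311 (axialMeasure gaussWeight)
open BIJ88InductiveForm41 (Prev prevMeasure)
open BIJ88RT51GeneralStep (IsRT511Ax)
open BIJ88RT51Exists (rt51 isRT511Ax_rt51_printed)
open BIJ85BlockAveragesTorus (qU measurable_qU)
open BIJ88RT52Restrictions (Fields fieldsMeasure IsRD measurable_proj3)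
open scoped BigOperators
open _root_.MeasureTheory _root_.MeasureTheory.Measure Complex Function

noncomputable section

variable {P : Params} {k : ℕ}

/-! ## §1 The cutoff profile (5.2.3)–(5.2.4) is bounded and continuous -/

/-- **r16's profile `χ(1, ·)` of (5.2.3) is bounded**: it is continuous (C^∞) and vanishes off `[−1, 1]` (the structure prints no bound
`χ ≤ 1`; a bound exists by compactness). [cite: BalabanImbrieJaffe1988, (5.2.3) p.278] -/
theorem exists_abs_chi1_le (χ : CutoffProfile) : ∃ M : ℝ, 0 ≤ M ∧ ∀ x, |χ.χ₁ x| ≤ M := by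
  obtain ⟨C, hC⟩ := (isCompact_Icc (a := (-1 : ℝ)) (b := 1)).exists_bound_of_continuousOn χ.smooth.continuous.continuousOn
  refine ⟨max C 0, le_max_right _ _, fun x => ?_⟩
  by_cases hx : x ∈ Set.Icc (-1 : ℝ) 1
  · exact (le_max_left _ _).trans' (by simpa only [Real.norm_eq_abs] using hC x hx)
  · have h1 : 1 ≤ |x| := by
      rcases not_and_or.mp hx with h | h
      · have : x < -1 := lt_of_not_ge h
        rw [abs_of_neg (by linarith)]; linarith
      · have : 1 < x := lt_of_not_ge h
        rw [abs_of_pos (by linarith)]; linarith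
    rw [χ.eq_zero x h1, abs_zero]; exact le_max_right _ _

/-- Hence all `χ(p, x) = χ(1, x/p)` ((5.2.4)) are bounded by one constant. [cite: BalabanImbrieJaffe1988, (5.2.4) p.278] -/
theorem exists_abs_cutoff_le (χ : CutoffProfile) : ∃ M : ℝ, 0 ≤ M ∧ ∀ p x, |cutoff χ p x| ≤ M := by
  obtain ⟨M, hM0, hM⟩ := exists_abs_chi1_le χ
  exact ⟨M, hM0, fun p x => hM _⟩

/-- `χ(p, ·)` is continuous ((5.2.3) "C^∞", (5.2.4)). [cite: BalabanImbrieJaffe1988, (5.2.4) p.278] -/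
theorem continuous_cutoff (χ : CutoffProfile) (p : ℝ) : Continuous (cutoff χ p) := by
  have h : cutoff χ p = fun x => χ.χ₁ (x / p) := funext fun x => rfl
  rw [h]
  exact χ.smooth.continuous.comp (continuous_id.div_const p)

/-! ## §2 The characteristic functions (5.2.2) as continuous / measurable bounded functions of the fields -/

/-- `χ_x = χ(·, |φ(x)|)` resp. `χ(·, ||φ(x)| − c|)` is continuous in `φ(x)`. [cite: BalabanImbrieJaffe1988, (5.2.2) p.278] -/
theorem continuous_chiX (χ : CutoffProfile) (lamk pek s lam : ℝ) (d : ℕ) : Continuous fun z : ℂ => chiX χ lamk pek s lam d z := by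
  unfold chiX
  split_ifs
  · exact (continuous_cutoff χ _).comp continuous_norm
  · exact (continuous_cutoff χ _).comp (continuous_norm.sub continuous_const)

/-- `χ_y = χ(p(e_k), |ψ(y) − (Q(u_k)φ)(y)|)` is continuous in `(ψ(y), (Q(u_k)φ)(y))`. [cite: BalabanImbrieJaffe1988, (5.2.2) p.278] -/
theorem continuous_chiY (χ : CutoffProfile) (pek : ℝ) : Continuous fun z : ℂ × ℂ => chiY χ pek z.1 z.2 := by
  unfold chiY
  exact (continuous_cutoff χ _).comp (continuous_fst.sub continuous_snd).norm

/-- `χ_b = χ(p(e_k), |(D_{ū_k}φ)(b)|)` is continuous in `(ū_k, φ)`. [cite: BalabanImbrieJaffe1988, (5.2.2) p.278] -/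
theorem continuous_chiB (χ : CutoffProfile) (pek : ℝ) (b : PBond P k) :
    Continuous fun w : (PBond P k → ℂ) × (Balaban1983to89.Site P k → ℂ) => chiB χ pek w.1 w.2 b := by
  have h1 : Continuous fun w : (PBond P k → ℂ) × (Balaban1983to89.Site P k → ℂ) => covD 1 w.1 w.2 b := by
    simp only [covD]
    exact continuous_const.mul
      ((((continuous_apply b).comp continuous_fst).mul ((continuous_apply b.tgt).comp continuous_snd)).sub
        ((continuous_apply b.src).comp continuous_snd))
  unfold chiB
  exact (continuous_cutoff χ _).comp h1.norm

/-- `χ_p = χ(e_kp(e_k), |u(p) − 1|)` is continuous in the bond field `u`. [cite: BalabanImbrieJaffe1988, (5.2.2) p.278] -/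
theorem continuous_chiP (χ : CutoffProfile) (ek pek : ℝ) (p : Balaban1983to89.Plaq P k) :
    Continuous fun u : PBond P k → ℂ => chiP χ ek pek (plaqVar u p) := by
  have h1 : Continuous fun u : PBond P k → ℂ => plaqVar u p := by
    unfold plaqVar
    exact (((continuous_apply (⟨p.src, p.μ⟩ : PBond P k)).mul (continuous_apply (⟨p.src.shift p.μ, p.ν⟩ : PBond P k))).mul
      (Complex.continuous_conj.comp (continuous_apply (⟨p.src.shift p.ν, p.μ⟩ : PBond P k)))).mul
        (Complex.continuous_conj.comp (continuous_apply (⟨p.src, p.ν⟩ : PBond P k)))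
  unfold chiP
  exact (continuous_cutoff χ _).comp (h1.sub continuous_const).norm

/-- The four SPECIES of points carrying a characteristic function in (5.2.1)–(5.2.2): sites `x ∈ Λ₁₃^{(k−1)′}` (unit lattice), block sites
`y ∈ Λ₁₃^{(k−1)″}` (the `L`-lattice), bonds `b ∈ Λ₁₃^{(k−1)′*}`, plaquettes `p ∈ Λ₁₃^{(k−1)′**}`. [cite: BalabanImbrieJaffe1988, (5.2.1) p.278] -/
abbrev Point (P : Params) (k : ℕ) : Type :=
  Balaban1983to89.Site P k ⊕ (Balaban1983to89.Site P (k+1) ⊕ (PBond P k ⊕ Balaban1983to89.Plaq P k))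

/-- The numerical parameters of (5.2.2): `λ_k`, `p(e_k)`, `L^kε`, `λ`, `e_k`. [cite: BalabanImbrieJaffe1988, (5.2.2) p.278] -/
structure Coeff522 where
  /-- `λ_k` (printed first radius of `χ_x`; see r16's transcription note at `chiX`) -/
  lamk : ℝ
  /-- `p(e_k)` -/
  pek : ℝ
  /-- `L^kε` -/
  s : ℝ
  /-- `λ` -/
  lam : ℝ
  /-- `e_k` -/
  ek : ℝ

/-- **(5.2.2) ON THE FIELDS, by species**: the printed characteristic function sitting at a point, as a function of the configuration
`({u^{(j)}}, u, φ, ψ)` — `χ_x(|φ(x)|)` (r16 `chiX`), `χ_y(|(ψ − Q(u_k)φ)(y)|)` (`chiY`; the background scalar average `Q(u_k)φ` of the term as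
data `Qφ₀`, as in (5.1.1)), `χ_b(|(D_{ū_k}φ)(b)|)` (`chiB`; the bond products `ū_k` of (4.4) of the term's background as data `ubar`),
`χ_p(|u(p) − 1|)` (`chiP`, `u(p)` = `plaqVar (cfg u) p`). [cite: BalabanImbrieJaffe1988, (5.2.2) p.278] -/
def chi522 (χ : CutoffProfile) (c : Coeff522) (Qφ₀ : Prev P k → GaugeField P k U1 → HiggsField P k → HiggsField P (k+1))
    (ubar : Prev P k → GaugeField P k U1 → (PBond P k → ℂ)) :
    Point P k → Prev P k → GaugeField P k U1 → HiggsField P k → HiggsField P (k+1) → ℝ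
  | Sum.inl x, _, _, φ, _ => chiX χ c.lamk c.pek c.s c.lam P.d (φ x)
  | Sum.inr (Sum.inl y), prev, U, φ, ψ => chiY χ c.pek (ψ y) (Qφ₀ prev U φ y)
  | Sum.inr (Sum.inr (Sum.inl b)), prev, U, φ, _ => chiB χ c.pek (ubar prev U) φ b
  | Sum.inr (Sum.inr (Sum.inr p)), _, U, _, _ => chiP χ c.ek c.pek (plaqVar (cfg U) p)

/-- kernel (plumbing): reading the gauge field through `cfg` is measurable on the configurations. [cite: BalabanImbrieJaffe1988, (5.2.2) p.278] -/
theorem measurable_cfg_fst : Measurable fun q : Fields P k => cfg q.1 :=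
  measurable_pi_lambda _ fun b => BIJ85RT33.measurable_toC.comp ((measurable_pi_apply b).comp measurable_fst)

/-- **The printed characteristic functions are jointly measurable on the configurations** (for jointly measurable `Q(u_k)φ` and `ū_k`).
[cite: BalabanImbrieJaffe1988, (5.2.2) p.278] -/
theorem measurable_chi522 (χ : CutoffProfile) (c : Coeff522)
    {Qφ₀ : Prev P k → GaugeField P k U1 → HiggsField P k → HiggsField P (k+1)} {ubar : Prev P k → GaugeField P k U1 → (PBond P k → ℂ)}
    (hQφ : Measurable fun p : Prev P k × (GaugeField P k U1 × HiggsField P k) => Qφ₀ p.1 p.2.1 p.2.2)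
    (hubar : Measurable fun p : Prev P k × GaugeField P k U1 => ubar p.1 p.2) (i : Point P k) :
    Measurable fun q : Fields P k => chi522 χ c Qφ₀ ubar i q.2.1 q.1 q.2.2.1 q.2.2.2 := by
  have hφ : Measurable fun q : Fields P k => q.2.2.1 := measurable_fst.comp (measurable_snd.comp measurable_snd)
  have hψ : Measurable fun q : Fields P k => q.2.2.2 := measurable_snd.comp (measurable_snd.comp measurable_snd)
  -- (gen 7's lesson: `exact lemma.comp h` against such goals makes the kernel unfold the carriers — go through `simpa [comp_def]`)
  rcases i with x | y | b | p
  · simp only [chi522]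
    have h2 := (continuous_chiX χ c.lamk c.pek c.s c.lam P.d).measurable.comp ((measurable_pi_apply x).comp hφ)
    simpa only [Function.comp_def] using h2
  · simp only [chi522]
    have h2 := (continuous_chiY χ c.pek).measurable.comp
      (((measurable_pi_apply y).comp hψ).prodMk ((measurable_pi_apply y).comp (hQφ.comp measurable_proj3)))
    simpa only [Function.comp_def] using h2
  · simp only [chi522]
    have h2 := (continuous_chiB χ c.pek b).measurable.comp
      ((hubar.comp ((measurable_fst.comp measurable_snd).prodMk measurable_fst)).prodMk hφ)
    simpa only [Function.comp_def] using h2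
  · simp only [chi522]
    have h2 := (continuous_chiP χ c.ek c.pek p).measurable.comp measurable_cfg_fst
    simpa only [Function.comp_def] using h2

/-- **The printed characteristic functions are uniformly bounded** on the configurations (all are values of `χ(p, ·)`).
[cite: BalabanImbrieJaffe1988, (5.2.2) p.278] -/
theorem exists_abs_chi522_le (χ : CutoffProfile) (c : Coeff522)
    (Qφ₀ : Prev P k → GaugeField P k U1 → HiggsField P k → HiggsField P (k+1)) (ubar : Prev P k → GaugeField P k U1 → (PBond P k → ℂ)) :
    ∃ M : ℝ, 0 ≤ M ∧ ∀ i prev U φ ψ, |chi522 χ c Qφ₀ ubar i prev U φ ψ| ≤ M := by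
  obtain ⟨M, hM0, hM⟩ := exists_abs_cutoff_le χ
  refine ⟨M, hM0, fun i prev U φ ψ => ?_⟩
  rcases i with x | y | b | p
  · simp only [chi522, chiX]; split_ifs <;> exact hM _ _
  · simp only [chi522, chiY]; exact hM _ _
  · simp only [chi522, chiB]; exact hM _ _
  · simp only [chi522, chiP]; exact hM _ _

/-! ## §3 The weight `ζ_{Λ₀^{(k)c}} χ_{Λ₀^{(k)}}` of (5.2.6)–(5.2.7) on the configurations -/

section Weight

variable {ιp : Type*} [DecidableEq ιp]

/-- **`ζ_{Λ₀^{(k)c}} χ_{Λ₀^{(k)}}` ON THE FIELDS**: r16's (5.2.7) weights `zeta527 · chi527` over the finite set `S` of points of `Λ₁₃^{(k−1)}` (all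
species), region map `Rmap` (*"compatible"*), at the FIELD-DEPENDENT characteristic functions `χf i ({u^{(j)}}, u, φ, ψ)`.
[cite: BalabanImbrieJaffe1988, (5.2.7) p.279] -/
def weight527 (S : Finset ιp) (Rmap : Finset ιp → Finset ιp)
    (χf : ιp → Prev P k → GaugeField P k U1 → HiggsField P k → HiggsField P (k+1) → ℝ) (Λ₀ : Finset ιp)
    (prev : Prev P k) (U : GaugeField P k U1) (φ : HiggsField P k) (ψ : HiggsField P (k+1)) : ℝ :=
  zeta527 S (fun i => χf i prev U φ ψ) Rmap Λ₀ * chi527 (fun i => χf i prev U φ ψ) Λ₀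

/-- **(5.2.6) at every configuration**: `Σ_{Λ₀^{(k)}} ζ_{Λ₀^{(k)c}} χ_{Λ₀^{(k)}} = 1` (r16's `eq526`, the sum over the regions that occur), read in `ℂ`.
[cite: BalabanImbrieJaffe1988, (5.2.6) p.279] -/
theorem sum_weight527 (S : Finset ιp) {Rmap : Finset ιp → Finset ιp} (hR : ∀ T ∈ S.powerset, Rmap T ⊆ S \ T)
    (χf : ιp → Prev P k → GaugeField P k U1 → HiggsField P k → HiggsField P (k+1) → ℝ)
    (prev : Prev P k) (U : GaugeField P k U1) (φ : HiggsField P k) (ψ : HiggsField P (k+1)) :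
    ∑ Λ₀ ∈ S.powerset.image Rmap, (weight527 S Rmap χf Λ₀ prev U φ ψ : ℂ) = 1 := by
  rw [← Complex.ofReal_sum]
  unfold weight527
  rw [eq526 S _ Rmap hR, Complex.ofReal_one]

/-- The weight is jointly measurable on the configurations when the `χ`'s are. [cite: BalabanImbrieJaffe1988, (5.2.7) p.279] -/
theorem measurable_weight527 (S : Finset ιp) (Rmap : Finset ιp → Finset ιp)
    {χf : ιp → Prev P k → GaugeField P k U1 → HiggsField P k → HiggsField P (k+1) → ℝ}
    (hχ : ∀ i, Measurable fun q : Fields P k => χf i q.2.1 q.1 q.2.2.1 q.2.2.2) (Λ₀ : Finset ιp) :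
    Measurable fun q : Fields P k => weight527 S Rmap χf Λ₀ q.2.1 q.1 q.2.2.1 q.2.2.2 := by
  unfold weight527 zeta527 chi527
  refine Measurable.mul (Finset.measurable_sum _ fun T _ => Measurable.mul (Finset.measurable_prod _ fun x _ => ?_)
    (Finset.measurable_prod _ fun x _ => hχ x)) (Finset.measurable_prod _ fun x _ => hχ x)
  exact measurable_const.sub (hχ x)

omit [DecidableEq ιp] in
/-- kernel: a finite product of bounded real functions is bounded. [cite: BalabanImbrieJaffe1988, (5.2.7) p.279] -/
theorem exists_abs_prod_le {α : Type*} (A : Finset ιp) {f : ιp → α → ℝ} (h : ∀ i, ∃ C : ℝ, ∀ a, |f i a| ≤ C) :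
    ∃ C : ℝ, ∀ a, |∏ i ∈ A, f i a| ≤ C := by
  classical
  induction A using Finset.induction_on with
  | empty => exact ⟨1, fun a => by simp⟩
  | insert i A hi ih =>
    obtain ⟨C, hC⟩ := ih
    obtain ⟨Ci, hCi⟩ := h i
    refine ⟨Ci * C, fun a => ?_⟩
    rw [Finset.prod_insert hi, abs_mul]
    exact mul_le_mul (hCi a) (hC a) (abs_nonneg _) ((abs_nonneg _).trans (hCi a))

omit [DecidableEq ιp] in
/-- kernel: a finite sum of bounded real functions is bounded. [cite: BalabanImbrieJaffe1988, (5.2.7) p.279] -/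
theorem exists_abs_sum_le {α β : Type*} (A : Finset β) {f : β → α → ℝ} (h : ∀ i ∈ A, ∃ C : ℝ, ∀ a, |f i a| ≤ C) :
    ∃ C : ℝ, ∀ a, |∑ i ∈ A, f i a| ≤ C := by
  classical
  induction A using Finset.induction_on with
  | empty => exact ⟨0, fun a => by simp⟩
  | insert i A hi ih =>
    obtain ⟨C, hC⟩ := ih fun j hj => h j (Finset.mem_insert_of_mem hj)
    obtain ⟨Ci, hCi⟩ := h i (Finset.mem_insert_self i A)
    refine ⟨Ci + C, fun a => ?_⟩
    rw [Finset.sum_insert hi]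
    exact (abs_add_le _ _).trans (add_le_add (hCi a) (hC a))

/-- The weight is bounded on the configurations when the `χ`'s are uniformly bounded. [cite: BalabanImbrieJaffe1988, (5.2.7) p.279] -/
theorem exists_norm_weight527_le (S : Finset ιp) (Rmap : Finset ιp → Finset ιp)
    {χf : ιp → Prev P k → GaugeField P k U1 → HiggsField P k → HiggsField P (k+1) → ℝ}
    (hχ : ∃ M : ℝ, ∀ i prev U φ ψ, |χf i prev U φ ψ| ≤ M) (Λ₀ : Finset ιp) :
    ∃ C : ℝ, ∀ q : Fields P k, ‖(weight527 S Rmap χf Λ₀ q.2.1 q.1 q.2.2.1 q.2.2.2 : ℂ)‖ ≤ C := by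
  obtain ⟨M, hM⟩ := hχ
  have hb : ∀ i, ∃ C : ℝ, ∀ q : Fields P k, |χf i q.2.1 q.1 q.2.2.1 q.2.2.2| ≤ C := fun i => ⟨M, fun q => hM i _ _ _ _⟩
  have hb' : ∀ i, ∃ C : ℝ, ∀ q : Fields P k, |1 - χf i q.2.1 q.1 q.2.2.1 q.2.2.2| ≤ C := fun i =>
    ⟨1 + M, fun q => (abs_sub _ _).trans (by rw [abs_one]; linarith [hM i q.2.1 q.1 q.2.2.1 q.2.2.2])⟩
  obtain ⟨Cζ, hCζ⟩ := exists_abs_sum_le (α := Fields P k) (S.powerset.filter fun T => Rmap T = Λ₀)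
    (f := fun T q => (∏ x ∈ T, (1 - χf x q.2.1 q.1 q.2.2.1 q.2.2.2)) * ∏ x ∈ (S \ T) \ Λ₀, χf x q.2.1 q.1 q.2.2.1 q.2.2.2)
    (fun T _ => by
      obtain ⟨C1, hC1⟩ := exists_abs_prod_le T hb'
      obtain ⟨C2, hC2⟩ := exists_abs_prod_le ((S \ T) \ Λ₀) hb
      exact ⟨C1 * C2, fun q => by
        rw [abs_mul]; exact mul_le_mul (hC1 q) (hC2 q) (abs_nonneg _) ((abs_nonneg _).trans (hC1 q))⟩)
  obtain ⟨Cχ, hCχ⟩ := exists_abs_prod_le Λ₀ hb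
  refine ⟨Cζ * Cχ, fun q => ?_⟩
  rw [Complex.norm_real, Real.norm_eq_abs, weight527, zeta527, chi527, abs_mul]
  exact mul_le_mul (hCζ q) (hCχ q) (abs_nonneg _) ((abs_nonneg _).trans (hCζ q))

end Weight

/-! ## §4 (5.2.8): the density after the restrictions -/

section Density

variable {ι ιp : Type*} [DecidableEq ιp] {terms : Finset ι} {Qu : GaugeField P k U1 → GaugeField P (k+1) U1}
variable {Qφ : ι → Prev P k → GaugeField P k U1 → HiggsField P k → HiggsField P (k+1)} {a : ℝ}
variable {ρ' : ι → Prev P k → GaugeField P k U1 → HiggsField P k → ℂ} {ρL : GaugeField P (k+1) U1 → HiggsField P (k+1) → ℂ}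

/-- **(5.2.8) for a general family of characteristic functions**: if `ρ̃` satisfies (5.1.1)+(5.1.4) (`IsRT511Ax`; `Qu` measurable, kernels
jointly measurable, `ρ′_t` jointly measurable and `𝒟u δ_{Ax} ⊗ Π𝒟u^{(j)} ⊗ 𝒟φ`-integrable, `a > 0`, `d ≥ 2`), and each term carries a finite set
`S_t` of points with jointly measurable, uniformly bounded field-dependent `χ`'s and a region map `Rmap_t` (*"compatible"*), then `ρ̃`
satisfies the display `Σ_t Σ_{Λ₀} ∫𝒟u δ(v/Qu) δ_{Ax}(u) ∫Π𝒟u^{(j)} ∫𝒟φ ζ_{Λ₀ᶜ} χ_{Λ₀} ρ′_t exp[−½aL⁻²⟨ψ − Q(u_k)φ, ·⟩ − E^{(k)}]` — file 1's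
`IsRT511Ax.insert_partition` at the (5.2.6) partition. [cite: BalabanImbrieJaffe1988, (5.2.8) p.279] -/
theorem density528_of_family (ha : 0 < a) (hd : 2 ≤ P.d) (h : IsRT511Ax terms Qu Qφ a ρ' ρL) (hQu : Measurable Qu)
    (hQφ : ∀ t ∈ terms, Measurable fun p : Prev P k × (GaugeField P k U1 × HiggsField P k) => Qφ t p.1 p.2.1 p.2.2)
    (hρm : ∀ t ∈ terms, Measurable fun p : Prev P k × (GaugeField P k U1 × HiggsField P k) => ρ' t p.1 p.2.1 p.2.2)
    (hρi : ∀ t ∈ terms, Integrable (fun q : GaugeField P k U1 × (Prev P k × HiggsField P k) => ρ' t q.2.1 q.1 q.2.2)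
      ((axialMeasure P k U1).prod ((prevMeasure P k).prod volume)))
    (S : ι → Finset ιp) (Rmap : ι → Finset ιp → Finset ιp) (hR : ∀ t ∈ terms, ∀ T ∈ (S t).powerset, Rmap t T ⊆ S t \ T)
    (χf : ι → ιp → Prev P k → GaugeField P k U1 → HiggsField P k → HiggsField P (k+1) → ℝ)
    (hχm : ∀ t ∈ terms, ∀ i, Measurable fun q : Fields P k => χf t i q.2.1 q.1 q.2.2.1 q.2.2.2)
    (hχb : ∀ t ∈ terms, ∃ M : ℝ, ∀ i prev U φ ψ, |χf t i prev U φ ψ| ≤ M) :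
    IsRD (axialMeasure P k U1) (terms.sigma fun t => (S t).powerset.image (Rmap t)) Qu (fun tr => Qφ tr.1) a
      (fun tr prev U φ ψ => (weight527 (S tr.1) (Rmap tr.1) (χf tr.1) tr.2 prev U φ ψ : ℂ) * ρ' tr.1 prev U φ) ρL :=
  BIJ88RT52Restrictions.IsRT511Ax.insert_partition ha hd h hQu hQφ hρm hρi (fun t => (S t).powerset.image (Rmap t))
    (fun t Λ₀ prev U φ ψ => (weight527 (S t) (Rmap t) (χf t) Λ₀ prev U φ ψ : ℂ))
    (fun t ht prev U φ ψ => sum_weight527 (S t) (hR t ht) (χf t) prev U φ ψ)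
    (fun t ht Λ₀ _ => Complex.measurable_ofReal.comp (measurable_weight527 (S t) (Rmap t) (hχm t ht) Λ₀))
    (fun t ht Λ₀ _ => exists_norm_weight527_le (S t) (Rmap t) (hχb t ht) Λ₀)

/-- **(5.2.8)** p. 279 [PDF 23] (verbatim in the module docstring) — *"Our density now has the form (5.2.8)"* — PROVED AT MEASURE LEVEL WITH
THE PRINTED CHARACTERISTIC FUNCTIONS: let `ρ̃ = ρ̃^L_{k+1}` satisfy the renormalization transformation (5.1.1) with the axial gauge conditions
(5.1.4) (gen 5's `IsRT511Ax terms Qu Qφ a ρ′ ρ̃`; for the terms of (4.1), `ρ′_t = rhoPrime (T t) ∘ cfg` = `χ_k Πg_k ΠF_{k,loc} Π[ZZ] exp[−½⟨f,σf⟩ −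
½⟨φ,Δφ⟩ − 𝒫 − ℰ_k]`), with `Qu` measurable, the background kernels `Q(u_k)φ` and bond products `ū_k` of each term jointly measurable, `ρ′_t`
jointly measurable and `𝒟u δ_{Ax} ⊗ Π𝒟u^{(j)} ⊗ 𝒟φ`-integrable, `a > 0`, `d ≥ 2`; let each term carry its finite set `S_t` of points of
`Λ₁₃^{(k−1)}` with species assignment `pt_t` and region map `Rmap_t`.  Then for every bounded measurable `g(v, ψ)`,
`∫dv dψ ρ̃ g = Σ_{{X_ω}} Σ_{Λ₀^{(k)}} ∫𝒟u δ_{Ax} ∫Π𝒟u^{(j)} ∫𝒟φ ∫dψ ζ_{Λ₀^{(k)c}} χ_{Λ₀^{(k)}} ρ′_k · exp[−½aL⁻²⟨ψ − Q(u_k)φ, ψ − Q(u_k)φ⟩ − |T_L|E^{(k)}] g(Qu, ψ)`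
with `ζ`, `χ` the printed (5.2.7) products of the printed `χ_x, χ_y, χ_b, χ_p` (5.2.2) on the fields — i.e.
`IsRD (𝒟u δ_{Ax}) (Σ_t regions_t) Qu (Q(u_k)φ) a (ζ_{Λ₀ᶜ}χ_{Λ₀} · ρ′_k) ρ̃`. [cite: BalabanImbrieJaffe1988, (5.2.8) p.279] -/
theorem density528 (ha : 0 < a) (hd : 2 ≤ P.d) (h : IsRT511Ax terms Qu Qφ a ρ' ρL) (hQu : Measurable Qu)
    (hQφ : ∀ t ∈ terms, Measurable fun p : Prev P k × (GaugeField P k U1 × HiggsField P k) => Qφ t p.1 p.2.1 p.2.2)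
    (hρm : ∀ t ∈ terms, Measurable fun p : Prev P k × (GaugeField P k U1 × HiggsField P k) => ρ' t p.1 p.2.1 p.2.2)
    (hρi : ∀ t ∈ terms, Integrable (fun q : GaugeField P k U1 × (Prev P k × HiggsField P k) => ρ' t q.2.1 q.1 q.2.2)
      ((axialMeasure P k U1).prod ((prevMeasure P k).prod volume)))
    (χ : CutoffProfile) (c : Coeff522) (ubar : ι → Prev P k → GaugeField P k U1 → (PBond P k → ℂ))
    (hubar : ∀ t ∈ terms, Measurable fun p : Prev P k × GaugeField P k U1 => ubar t p.1 p.2)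
    (S : ι → Finset ιp) (pt : ι → ιp → Point P k) (Rmap : ι → Finset ιp → Finset ιp)
    (hR : ∀ t ∈ terms, ∀ T ∈ (S t).powerset, Rmap t T ⊆ S t \ T) :
    IsRD (axialMeasure P k U1) (terms.sigma fun t => (S t).powerset.image (Rmap t)) Qu (fun tr => Qφ tr.1) a
      (fun tr prev U φ ψ =>
        (weight527 (S tr.1) (Rmap tr.1) (fun i => chi522 χ c (Qφ tr.1) (ubar tr.1) (pt tr.1 i)) tr.2 prev U φ ψ : ℂ) *
          ρ' tr.1 prev U φ) ρL :=
  density528_of_family ha hd h hQu hQφ hρm hρi S Rmap hR (fun t i => chi522 χ c (Qφ t) (ubar t) (pt t i))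
    (fun t ht i => measurable_chi522 χ c (hQφ t ht) (hubar t ht) (pt t i))
    (fun t _ => (exists_abs_chi522_le χ c (Qφ t) (ubar t)).elim fun M hM => ⟨M, fun i => hM.2 (pt t i)⟩)

/-- **(5.2.8) WITH NO HYPOTHESIS ON THE DENSITY**: for the PRINTED gauge-field block average `Qu` of [2] (2.10) (r18's
`BIJ85BlockAveragesTorus.qU`, Haar-regular in the axial gauge) and any term data as above, gen 6's CONSTRUCTED density `ρ̃^L_{k+1} =
rt51 (𝒟u δ_{Ax}) …` of (5.1.1)+(5.1.4) satisfies the display (5.2.8) with the printed characteristic functions (standing range `k + 1 ≤ m + K`).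
[cite: BalabanImbrieJaffe1988, (5.2.8) p.279] -/
theorem density528_rt51_printed (hk : k + 1 ≤ P.m + P.K) (ha : 0 < a) (hd : 2 ≤ P.d)
    (hQφ : ∀ t ∈ terms, Measurable fun p : Prev P k × (GaugeField P k U1 × HiggsField P k) => Qφ t p.1 p.2.1 p.2.2)
    (hρm : ∀ t ∈ terms, Measurable fun p : Prev P k × (GaugeField P k U1 × HiggsField P k) => ρ' t p.1 p.2.1 p.2.2)
    (hρi : ∀ t ∈ terms, Integrable (fun q : GaugeField P k U1 × (Prev P k × HiggsField P k) => ρ' t q.2.1 q.1 q.2.2)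
      ((axialMeasure P k U1).prod ((prevMeasure P k).prod volume)))
    (χ : CutoffProfile) (c : Coeff522) (ubar : ι → Prev P k → GaugeField P k U1 → (PBond P k → ℂ))
    (hubar : ∀ t ∈ terms, Measurable fun p : Prev P k × GaugeField P k U1 => ubar t p.1 p.2)
    (S : ι → Finset ιp) (pt : ι → ιp → Point P k) (Rmap : ι → Finset ιp → Finset ιp)
    (hR : ∀ t ∈ terms, ∀ T ∈ (S t).powerset, Rmap t T ⊆ S t \ T) :
    IsRD (axialMeasure P k U1) (terms.sigma fun t => (S t).powerset.image (Rmap t)) qU (fun tr => Qφ tr.1) a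
      (fun tr prev U φ ψ =>
        (weight527 (S tr.1) (Rmap tr.1) (fun i => chi522 χ c (Qφ tr.1) (ubar tr.1) (pt tr.1 i)) tr.2 prev U φ ψ : ℂ) *
          ρ' tr.1 prev U φ)
      (rt51 (axialMeasure P k U1) terms qU Qφ a ρ') :=
  density528 ha hd (isRT511Ax_rt51_printed hk ha hd hQφ hρm hρi) measurable_qU hQφ hρm hρi χ c ubar hubar S pt Rmap hR

end Density

end

end Literature.MathematicalPhysics.QuantumFieldTheory.BalabanImbrieJaffe1984to88.BIJ88Eq528Density
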